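import Summits.QuantumFields.YangMills.Theorems.BalabanLadderNTClassicalShadow
import Summits.QuantumFields.YangMills.Theorems.BalabanLadderNTBoundaryLawSymmetry
import Summits.QuantumFields.YangMills.Theorems.PencilRigidityCurvatureKernelBoundCurvatureSwapCovariance
import Summits.QuantumFields.YangMills.Theorems.LangevinControlUVOSLegsFromFemtoAndGapStubLowerMoments
import HarnessLib

/-!
# Crux `NT` (stmt-QuantumFields-19353), stub `stub_refpkgT : RefPkgT`: THE CLASSICAL SHADOW, II — the symmetric two-valley
# test: clause 2 prices a degenerate (symmetry-broken) ground state of a frustrated femto box by the density CONTRAST of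
# its valleys, `C₂ ≥ Δ²·min(d_x,d_y)⁴(1 + ‖y − x‖)⁴/4`

Helper file (`--supports stmt-QuantumFields-19353`) of the fleet lead prover of crux `NT` (unit `ym-spine-19353-p1`, GEN 14); sequel
of `…NTClassicalShadow` (p598990).

THE MECHANISM.  Clause 2 of the registered package bounds the exterior-oscillation of the conditional covariance
`kerCov^η_β(dens_x, dens_y)` by `C₂/min(d_x,d_y)⁴/(1+‖y−x‖)⁴`, uniformly in `β ≥ β₂`; at fixed lattice geometry `β → ∞` is
admissible (`a(β) → 0`) and the identity exterior has `kerCov^1_β → 0` (`ClassicalShadow.tendsto_kerCov_one_dens`).  Suppose an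
exterior `η` has a DEGENERATE classical ground state in the following (symmetric two-valley) sense: on the ground-state set
`cubeMinimisers c b η` the sum `dens_x + dens_y` is a constant `s` and the squared contrast `(dens_x − dens_y)²` is a constant `Δ²`
(two valleys `A`, `B` exchanged by a symmetry swapping `x ↔ y`, with `(dens_x, dens_y) = (a₁, a₂)` on `A` and `(a₂, a₁)` on `B`:
`s = a₁ + a₂`, `Δ = a₁ − a₂`), and the kernel is `x ↔ y` symmetric at every `β` (`kerE^η_β(dens_x) = kerE^η_β(dens_y)`).  Then WITHOUT
knowing how the zero-temperature law splits its mass between the valleys (thermal order-by-disorder):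

* §2 `tendsto_kerE_dens_of_twoValley` — `kerE^η_β(dens_x) → s/2`; **`tendsto_kerCov_of_twoValley` — `kerCov^η_β(dens_x, dens_y) → −Δ²/4`**
  (`dens_x·dens_y = (s² − Δ²)/4` and `dens_x + dens_y = s` are constant on the ground states, so their kernel means converge by the
  Laplace step; symmetry gives `kerE(dens_x) = kerE(dens_x + dens_y)/2`);
* §3 **`contrast_le_of_e2osc_twoValley`** — clause 2 (registered `∃ β₂ ∀ β ≥ β₂` shape, `a → 0`, `ℓ > 0`, constant `C₂`) forces
  **`Δ²/4 ≤ C₂ / min(d_x,d_y)⁴ / (1 + ‖y − x‖)⁴`** for every such exterior at depths `≥ 2`, i.e. (`C₂_ge_of_twoValley`)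
  **`C₂ ≥ Δ² · min(d_x,d_y)⁴ · (1 + ‖y − x‖)⁴ / 4`** — a ground state that breaks an `x ↔ y` symmetry with density contrast `Δ` at
  separation `n` COSTS `Δ² n⁴ d⁴/4` units of `C₂`; a family of such exteriors with `Δ` bounded below at unbounded separation would refute
  clause 2 outright.  `mean_deficit_le_of_e1osc_twoValley` — clause 1 forces the valley MEAN `s/2 ≥ 6N − C₁/d_x⁴`.
* §1/§4 the symmetry supplied by the tree: a coordinate swap `i ↔ j` fixing the cube base (`c ∘ swap = c`) and the exterior
  (`relabelConfig (edgePerm (swap i j)) η = η`) gives `kerE^η_β(dens_x) = kerE^η_β(dens_{x∘swap})` (`kerE_dens_swap_symm`, from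
  `BoundaryLaw.kerE_perm` and the PencilRigidity desk's `CurvatureSwapCovariance`), whence the geometric corollary
  **`contrast_le_of_e2osc_swapValley`** for `y = x ∘ swap i j`.

This is the classical programme's next target after PENETRATION (clause 1, decided FUNNEL by the disprover's kit): search for
coherent exteriors whose Wilson-action minimisers in a `b⁴` box break a diagonal-mirror symmetry (cooling from random starts landing in
two mirror-image valleys), and measure the contrast `Δ` of the corner density between a deep site and its mirror image.

HONEST FRAMING.  Consequences of the registered clauses at fixed lattice geometry as `β → ∞`; necessary conditions on instances; nothing
here asserts that a two-valley exterior exists; no floor, not AF, not NT, not the seam, not the gap; not Clay.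
-/

set_option autoImplicit false

noncomputable section

open MeasureTheory Filter Topology
open Literature.MathematicalPhysics.QuantumFieldTheory Literature.MathematicalPhysics.QuantumLattice
open Literature.Probability.LatticeModels
open Summit.QuantumFields.YangMills.Cruxes.OSLegsFromFemtoAndGap.DlrCollarTransfer
open Summit.QuantumFields.YangMills.Cruxes.UVSeamRec.BoundaryLawPenetration
open Summit.QuantumFields.YangMills.Theorems.OSLegsFromFemtoAndGap.StubLower (integrable_of_continuous_compact)

namespace Summit.QuantumFields.YangMills.Cruxes.NT.ClassicalShadow

variable {G : Type} [Group G] [TopologicalSpace G] [IsTopologicalGroup G] [CompactSpace G]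
  [MeasurableSpace G] [BorelSpace G] (r : LatticeRep G)

/-! ## §1 The swap symmetry of the density and of the kernels -/

/-- **The corner density is swap-covariant**: relabelling a configuration along the coordinate swap `i ↔ j` and reading the density at
`x` is reading the density of the original configuration at `x ∘ swap i j` (PencilRigidity desk's `CurvatureSwapCovariance`). [folklore] -/
theorem dens_swap (i j : Fin 4) (x : Fin 4 → ℤ) (U : LGConfig 4 G) :
    dens G r x (relabelConfig (edgePerm (Equiv.swap i j)) U) = dens G r (x ∘ Equiv.swap i j) U := by
  have h := Summit.QuantumFields.YangMills.Theorems.CurvatureKernel.CurvatureSwapCovariance r.ρ r.mem_unitary i j U x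
  have e : (relabelConfig (edgePerm (Equiv.swap i j)) U : LGConfig 4 G) =
      fun e : Literature.MathematicalPhysics.QuantumLattice.ZdEdge 4 => U (e.1 ∘ Equiv.swap i j, Equiv.swap i j e.2) := by
    funext e
    rw [relabelConfig_apply]
    simp only [edgePerm, Equiv.prodCongr_symm, Equiv.prodCongr_apply, sitePerm_symm, Equiv.symm_swap, Prod.map]
    rfl
  show actionDensity r.ρ (configShift (-x) (relabelConfig (edgePerm (Equiv.swap i j)) U)) =
    actionDensity r.ρ (configShift (-(x ∘ Equiv.swap i j)) U)
  rw [e]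
  exact h

/-- **Swap-symmetric exteriors have swap-symmetric kernels**: if the cube base and the exterior are invariant under the coordinate
swap `i ↔ j`, then `kerE^η_β(dens_x) = kerE^η_β(dens_{x ∘ swap})`. [folklore] -/
theorem kerE_dens_swap_symm (i j : Fin 4) (β : ℝ) {c : Fin 4 → ℤ} (hc : c ∘ Equiv.swap i j = c) (b : ℕ) {η : LGConfig 4 G}
    (hη : relabelConfig (edgePerm (Equiv.swap i j)) η = η) (x : Fin 4 → ℤ) :
    kerE G r β c b η (dens G r x) = kerE G r β c b η (dens G r (x ∘ Equiv.swap i j)) := by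
  have hc' : sitePerm (Equiv.swap i j) c = c := by
    funext k; rw [sitePerm_apply, Equiv.symm_swap]; exact congrFun hc k
  have h := Summit.QuantumFields.YangMills.Cruxes.NT.BoundaryLaw.kerE_perm G r (Equiv.swap i j) β c b η (dens G r x)
  rw [hc', hη] at h
  rw [h]
  congr 1
  funext U
  exact dens_swap r i j x U

/-! ## §2 Zero-temperature kernel means of a symmetric two-valley exterior -/

section TwoValley

variable (c : Fin 4 → ℤ) (b : ℕ) (η : LGConfig 4 G) {x y : Fin 4 → ℤ} {s Δ2 : ℝ}

/-- Linearity: `kerE(dens_x + dens_y) = kerE(dens_x) + kerE(dens_y)`. [folklore] -/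
theorem kerE_dens_add (β : ℝ) (x y : Fin 4 → ℤ) :
    kerE G r β c b η (fun U => dens G r x U + dens G r y U) = kerE G r β c b η (dens G r x) + kerE G r β c b η (dens G r y) := by
  haveI : SecondCountableTopology G := (Continuous.isClosedEmbedding r.continuous r.injective).isEmbedding.secondCountableTopology
  haveI := isProbabilityMeasure_ymSpecification r.ρ r.continuous β (cubeEdges c b) η
  unfold kerE
  exact integral_add (integrable_of_continuous_compact (continuous_dens r x)) (integrable_of_continuous_compact (continuous_dens r y))

/-- **The one-point mean of a symmetric two-valley exterior**: `kerE^η_β(dens_x) → s/2`. [folklore] -/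
theorem tendsto_kerE_dens_of_twoValley
    (hsum : ∀ ζ ∈ cubeMinimisers G r c b η, dens G r x (glueWith (cubeEdges c b) ζ η) + dens G r y (glueWith (cubeEdges c b) ζ η) = s)
    (hsymm : ∀ β : ℝ, kerE G r β c b η (dens G r x) = kerE G r β c b η (dens G r y)) :
    Tendsto (fun β : ℝ => kerE G r β c b η (dens G r x)) atTop (𝓝 (s / 2)) := by
  have h := tendsto_kerE_of_eq_on_cubeMinimisers r c b η ((continuous_dens r x).add (continuous_dens r y)) hsum
  have e : ∀ β : ℝ, kerE G r β c b η (dens G r x) = kerE G r β c b η (fun U => dens G r x U + dens G r y U) / 2 := fun β => by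
    rw [kerE_dens_add, ← hsymm β]; ring
  simp_rw [e]
  exact h.div_const 2

/-- **The conditional covariance of a symmetric two-valley exterior**: `kerCov^η_β(dens_x, dens_y) → −Δ²/4`, whatever the split of the
zero-temperature mass between the valleys. [folklore] -/
theorem tendsto_kerCov_of_twoValley
    (hsum : ∀ ζ ∈ cubeMinimisers G r c b η, dens G r x (glueWith (cubeEdges c b) ζ η) + dens G r y (glueWith (cubeEdges c b) ζ η) = s)
    (hdiff : ∀ ζ ∈ cubeMinimisers G r c b η,
      (dens G r x (glueWith (cubeEdges c b) ζ η) - dens G r y (glueWith (cubeEdges c b) ζ η)) ^ 2 = Δ2)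
    (hsymm : ∀ β : ℝ, kerE G r β c b η (dens G r x) = kerE G r β c b η (dens G r y)) :
    Tendsto (fun β : ℝ => kerCov G r β c b η (dens G r x) (dens G r y)) atTop (𝓝 (-(Δ2 / 4))) := by
  -- the product is constant on the ground states: `dens_x dens_y = ((dens_x + dens_y)² − (dens_x − dens_y)²)/4 = (s² − Δ²)/4`
  have hprod : ∀ ζ ∈ cubeMinimisers G r c b η,
      dens G r x (glueWith (cubeEdges c b) ζ η) * dens G r y (glueWith (cubeEdges c b) ζ η) = (s ^ 2 - Δ2) / 4 := by
    intro ζ hζ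
    have e : ∀ u v : ℝ, u * v = ((u + v) ^ 2 - (u - v) ^ 2) / 4 := fun u v => by ring
    rw [e, hsum ζ hζ, hdiff ζ hζ]
  have hP := tendsto_kerE_of_eq_on_cubeMinimisers r c b η ((continuous_dens r x).mul (continuous_dens r y)) hprod
  have hX := tendsto_kerE_dens_of_twoValley r c b η hsum hsymm
  have hY : Tendsto (fun β : ℝ => kerE G r β c b η (dens G r y)) atTop (𝓝 (s / 2)) := by
    refine hX.congr' (Eventually.of_forall fun β => hsymm β)
  have h := hP.sub (hX.mul hY)
  have e : (s ^ 2 - Δ2) / 4 - s / 2 * (s / 2) = -(Δ2 / 4) := by ring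
  rw [e] at h
  exact h

end TwoValley

/-! ## §3 The prices: clause 2 against the contrast, clause 1 against the valley mean -/

section Price

variable (a : ℝ → ℝ)

/-- **Clause 2 prices a symmetric two-valley exterior by its contrast**: `Δ²/4 ≤ C₂ / min(d_x,d_y)⁴ / (1 + ‖y − x‖)⁴`. [folklore] -/
theorem contrast_le_of_e2osc_twoValley (ha0 : Tendsto a atTop (𝓝 0)) {C₂ ℓ : ℝ} (hℓ : 0 < ℓ)
    (hE2 : ∃ β₂ : ℝ, ∀ β : ℝ, β₂ ≤ β → ∀ (c : Fin 4 → ℤ) (b : ℕ), (b : ℝ) * a β ≤ ℓ →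
      ∀ (η η' : LGConfig 4 G) (x y : Fin 4 → ℤ), 1 ≤ depth c b x → 1 ≤ depth c b y →
        |kerCov G r β c b η (dens G r x) (dens G r y) - kerCov G r β c b η' (dens G r x) (dens G r y)| ≤
          C₂ / ((min (depth c b x) (depth c b y) : ℕ) : ℝ) ^ 4 / (1 + ‖siteToE (y - x)‖) ^ 4)
    (c : Fin 4 → ℤ) (b : ℕ) {x y : Fin 4 → ℤ} (hx : 2 ≤ depth c b x) (hy : 2 ≤ depth c b y) (η : LGConfig 4 G) {s Δ2 : ℝ}
    (hsum : ∀ ζ ∈ cubeMinimisers G r c b η, dens G r x (glueWith (cubeEdges c b) ζ η) + dens G r y (glueWith (cubeEdges c b) ζ η) = s)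
    (hdiff : ∀ ζ ∈ cubeMinimisers G r c b η,
      (dens G r x (glueWith (cubeEdges c b) ζ η) - dens G r y (glueWith (cubeEdges c b) ζ η)) ^ 2 = Δ2)
    (hsymm : ∀ β : ℝ, kerE G r β c b η (dens G r x) = kerE G r β c b η (dens G r y)) :
    Δ2 / 4 ≤ C₂ / ((min (depth c b x) (depth c b y) : ℕ) : ℝ) ^ 4 / (1 + ‖siteToE (y - x)‖) ^ 4 := by
  obtain ⟨β₂, H2⟩ := hE2
  have hlim : Tendsto (fun β : ℝ => |kerCov G r β c b η (dens G r x) (dens G r y) - kerCov G r β c b 1 (dens G r x) (dens G r y)|)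
      atTop (𝓝 (Δ2 / 4)) := by
    have h := ((tendsto_kerCov_of_twoValley r c b η hsum hdiff hsymm).sub (tendsto_kerCov_one_dens r c b hx hy)).abs
    have hΔ : 0 ≤ Δ2 := by
      obtain ⟨ζ, hζ⟩ := cubeMinimisers_nonempty (G := G) (r := r) c b η
      rw [← hdiff ζ hζ]; positivity
    rwa [sub_zero, abs_neg, abs_of_nonneg (by positivity : (0 : ℝ) ≤ Δ2 / 4)] at h
  refine le_of_tendsto hlim ?_
  filter_upwards [eventually_mul_le_of_tendsto_zero ha0 hℓ b, eventually_ge_atTop β₂] with β hb hβ2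
  exact H2 β hβ2 c b hb η 1 x y (le_trans one_le_two hx) (le_trans one_le_two hy)

/-- **`C₂ ≥ Δ² · min(d_x,d_y)⁴ · (1 + ‖y − x‖)⁴ / 4`** — the same, solved for the constant. [folklore] -/
theorem C₂_ge_of_twoValley (ha0 : Tendsto a atTop (𝓝 0)) {C₂ ℓ : ℝ} (hℓ : 0 < ℓ)
    (hE2 : ∃ β₂ : ℝ, ∀ β : ℝ, β₂ ≤ β → ∀ (c : Fin 4 → ℤ) (b : ℕ), (b : ℝ) * a β ≤ ℓ →
      ∀ (η η' : LGConfig 4 G) (x y : Fin 4 → ℤ), 1 ≤ depth c b x → 1 ≤ depth c b y →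
        |kerCov G r β c b η (dens G r x) (dens G r y) - kerCov G r β c b η' (dens G r x) (dens G r y)| ≤
          C₂ / ((min (depth c b x) (depth c b y) : ℕ) : ℝ) ^ 4 / (1 + ‖siteToE (y - x)‖) ^ 4)
    (c : Fin 4 → ℤ) (b : ℕ) {x y : Fin 4 → ℤ} (hx : 2 ≤ depth c b x) (hy : 2 ≤ depth c b y) (η : LGConfig 4 G) {s Δ2 : ℝ}
    (hsum : ∀ ζ ∈ cubeMinimisers G r c b η, dens G r x (glueWith (cubeEdges c b) ζ η) + dens G r y (glueWith (cubeEdges c b) ζ η) = s)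
    (hdiff : ∀ ζ ∈ cubeMinimisers G r c b η,
      (dens G r x (glueWith (cubeEdges c b) ζ η) - dens G r y (glueWith (cubeEdges c b) ζ η)) ^ 2 = Δ2)
    (hsymm : ∀ β : ℝ, kerE G r β c b η (dens G r x) = kerE G r β c b η (dens G r y)) :
    Δ2 * ((min (depth c b x) (depth c b y) : ℕ) : ℝ) ^ 4 * (1 + ‖siteToE (y - x)‖) ^ 4 / 4 ≤ C₂ := by
  have h := contrast_le_of_e2osc_twoValley r a ha0 hℓ hE2 c b hx hy η hsum hdiff hsymm
  have hd : (0 : ℝ) < ((min (depth c b x) (depth c b y) : ℕ) : ℝ) ^ 4 := by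
    have : 1 ≤ min (depth c b x) (depth c b y) := le_min (le_trans one_le_two hx) (le_trans one_le_two hy)
    positivity
  have hn : (0 : ℝ) < (1 + ‖siteToE (y - x)‖) ^ 4 := by positivity
  rw [le_div_iff₀ hn, le_div_iff₀ hd] at h
  have e : Δ2 * ((min (depth c b x) (depth c b y) : ℕ) : ℝ) ^ 4 * (1 + ‖siteToE (y - x)‖) ^ 4 / 4 =
      Δ2 / 4 * (1 + ‖siteToE (y - x)‖) ^ 4 * ((min (depth c b x) (depth c b y) : ℕ) : ℝ) ^ 4 := by ring
  rw [e]
  exact h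

/-- **Clause 1 prices the valley MEAN**: for a symmetric two-valley exterior, `6N − C₁/d_x⁴ ≤ s/2`. [folklore] -/
theorem mean_deficit_le_of_e1osc_twoValley (ha0 : Tendsto a atTop (𝓝 0)) {C₁ ℓ : ℝ} (hℓ : 0 < ℓ)
    (hE1 : ∃ β₁ : ℝ, ∀ β : ℝ, β₁ ≤ β → ∀ (c : Fin 4 → ℤ) (b : ℕ), (b : ℝ) * a β ≤ ℓ →
      ∀ (η η' : LGConfig 4 G) (x : Fin 4 → ℤ), 1 ≤ depth c b x →
        |kerE G r β c b η (dens G r x) - kerE G r β c b η' (dens G r x)| ≤ C₁ / (depth c b x : ℝ) ^ 4)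
    (c : Fin 4 → ℤ) (b : ℕ) {x y : Fin 4 → ℤ} (hx : 2 ≤ depth c b x) (η : LGConfig 4 G) {s : ℝ}
    (hsum : ∀ ζ ∈ cubeMinimisers G r c b η, dens G r x (glueWith (cubeEdges c b) ζ η) + dens G r y (glueWith (cubeEdges c b) ζ η) = s)
    (hsymm : ∀ β : ℝ, kerE G r β c b η (dens G r x) = kerE G r β c b η (dens G r y)) :
    6 * (r.N : ℝ) - C₁ / (depth c b x : ℝ) ^ 4 ≤ s / 2 := by
  obtain ⟨β₁, H1⟩ := hE1
  have hlim : Tendsto (fun β : ℝ => kerE G r β c b 1 (dens G r x) - kerE G r β c b η (dens G r x)) atTop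
      (𝓝 (6 * (r.N : ℝ) - s / 2)) :=
    (tendsto_kerE_one_dens r c b hx).sub (tendsto_kerE_dens_of_twoValley r c b η hsum hsymm)
  have h : 6 * (r.N : ℝ) - s / 2 ≤ C₁ / (depth c b x : ℝ) ^ 4 := by
    refine le_of_tendsto hlim ?_
    filter_upwards [eventually_mul_le_of_tendsto_zero ha0 hℓ b, eventually_ge_atTop β₁] with β hb hβ1
    exact (le_abs_self _).trans (H1 β hβ1 c b hb 1 η x (le_trans one_le_two hx))
  linarith

end Price

/-! ## §4 The geometric corollary: a diagonal mirror `i ↔ j` -/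

section Swap

variable (a : ℝ → ℝ)

/-- **Clause 2 against a diagonal-mirror-broken ground state.**  Cube base and exterior invariant under the coordinate swap `i ↔ j`,
`y = x ∘ swap i j`, both of depth `≥ 2`; if on the ground states `dens_x + dens_y = s` and `(dens_x − dens_y)² = Δ²`, then
`Δ²/4 ≤ C₂ / min(d_x,d_y)⁴ / (1 + ‖y − x‖)⁴`. [folklore] -/
theorem contrast_le_of_e2osc_swapValley (ha0 : Tendsto a atTop (𝓝 0)) {C₂ ℓ : ℝ} (hℓ : 0 < ℓ)
    (hE2 : ∃ β₂ : ℝ, ∀ β : ℝ, β₂ ≤ β → ∀ (c : Fin 4 → ℤ) (b : ℕ), (b : ℝ) * a β ≤ ℓ →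
      ∀ (η η' : LGConfig 4 G) (x y : Fin 4 → ℤ), 1 ≤ depth c b x → 1 ≤ depth c b y →
        |kerCov G r β c b η (dens G r x) (dens G r y) - kerCov G r β c b η' (dens G r x) (dens G r y)| ≤
          C₂ / ((min (depth c b x) (depth c b y) : ℕ) : ℝ) ^ 4 / (1 + ‖siteToE (y - x)‖) ^ 4)
    (i j : Fin 4) {c : Fin 4 → ℤ} (hc : c ∘ Equiv.swap i j = c) (b : ℕ) {η : LGConfig 4 G}
    (hη : relabelConfig (edgePerm (Equiv.swap i j)) η = η) {x : Fin 4 → ℤ} (hx : 2 ≤ depth c b x)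
    (hy : 2 ≤ depth c b (x ∘ Equiv.swap i j)) {s Δ2 : ℝ}
    (hsum : ∀ ζ ∈ cubeMinimisers G r c b η,
      dens G r x (glueWith (cubeEdges c b) ζ η) + dens G r (x ∘ Equiv.swap i j) (glueWith (cubeEdges c b) ζ η) = s)
    (hdiff : ∀ ζ ∈ cubeMinimisers G r c b η,
      (dens G r x (glueWith (cubeEdges c b) ζ η) - dens G r (x ∘ Equiv.swap i j) (glueWith (cubeEdges c b) ζ η)) ^ 2 = Δ2) :
    Δ2 / 4 ≤ C₂ / ((min (depth c b x) (depth c b (x ∘ Equiv.swap i j)) : ℕ) : ℝ) ^ 4 /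
      (1 + ‖siteToE (x ∘ Equiv.swap i j - x)‖) ^ 4 :=
  contrast_le_of_e2osc_twoValley r a ha0 hℓ hE2 c b hx hy η hsum hdiff fun β => kerE_dens_swap_symm r i j β hc b hη x

end Swap

end Summit.QuantumFields.YangMills.Cruxes.NT.ClassicalShadow

end
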